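import Summits.QuantumFields.QCD.Theorems.WilsonMobilityGapMobilityGapSketchDeepWindowComp
import Summits.QuantumFields.QCD.Theorems.WilsonMobilityGapMobilityGapSketchWindowMono
import Summits.QuantumFields.QCD.Theorems.WilsonMobilityGapMobilityGapSketchWindowDOS
import Literature.Barriers.QuantumFields.WilsonDeterminantSign

/-!
# Crux `MobilityGap` (stmt-QuantumFields-9150) — line `Ideator6Sketch` (card `integer-pinch-unitary-point`), skeleton v1

Lead a1 (2026-08-16).  The round-2 ideator's file `Cruxes/MobilityGap/Ideator6Sketch.lean` is a first-lemma file, not a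
skeleton; this skeleton is cut by the lead from the card's stub architecture S1–S5 (`Ideas/integer-pinch-unitary-point.md`).

THE CORE CHAIN (new).  The kernel-checked necessary core of the crux is `LawLightFree` (`∀ N_f ∈ {2,3}, LightMomentFree N_f`,
`lawLightFree_of_mobilityGap`, p116312).  The card manufactures it as follows, and the four steps are the four NEW stubs:
* `stub_pocketPlateau` (S1a) — an Aizenman–Molchanov (fractional-moment) bound for the VALENCE resolvent of
  `Γ₅ D_W(U, m₀, 1)` in the doubler pocket `m₀ ∈ [-3/2, -1]`, under the Wilson measure at every weak coupling `β ≥ β₁`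
  reweighted by the phase-quenched sea `|det D_W(U, x, 1)|^{N_f}`, for EVERY sea mass `x ∈ [-1, 1]` (the sea-uniform twin of
  `IntegerCriticalLine.InteriorPlateauLocalisation`, stmt-9690);
* `stub_valencePinch` (S1b) — the plateau principle: the pocket bound forces the FAILURE of any valence FM bound uniform over
  `m₀ ∈ [-1, 1]` (second Chern number `-3` in the pocket, `0` on the trivial plateau `m₀ > 0`, constant along FM intervals of
  one fixed link law) — conclusion = the ideator's `ValenceDelocalisationPQ N_f` (twin of `IntegerCriticalLine.CriticalLineExists`,
  stmt-9692);
* `stub_unitaryMatching` (S2, THE BET) — continuity of the sea law in the sea mass closes the loop `m₀*(x_u) = x_u`: at every weak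
  coupling there is a sea = valence mass `x_u ∈ (-1, 0]` at which NO FM bound holds for the valence resolvent at valence mass `x_u`
  under the sea `x_u` (the unitary / Aoki point; FALSE in the Sharpe–Singleton scenario — card §Barriers);
* `stub_aokiLRO` (S3) — at (or just inside) the unitary point the flavour-parity condensate has long-range order, which the exact
  twisted Ward sum rule (`twistedWardSumRule_wilson`, landed p128220) converts configuration-wise into a volume-uniform pointwise
  LOWER bound on the phase-quenched SECOND moment of the propagator entry sum along the time axis, together with a uniform
  integrable `q`-moment, `q > 2` — conclusion = the ideator's `SecondMomentPoint N_f aSeq (betaSeq N_f) q` (unfolded), along the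
  canonical admissible data `a_k = e^{-(k+1)}`, `β_k = afBeta N_f 1 a_k`;
* S4 (CLOSED, glue below: `lightMomentAt_of_secondMomentPoint`, the ideator's Hölder descent through the landed
  `moment_interpolation`) — `SecondMomentPoint` ⇒ `LightMomentAt … s` for every `s ∈ (0,1)` with rate `0`, hence `LawLightFree`.

THE DRESSING (card S5: "(ii) no longer free, (iii) GMOR-type scaling, (iv) untouched — open-problem, shared with every line").
The only kernel-checked composition on file that USES the core is the threshold composition `MobilityGap_of_freeLaws_deepWindow`
(landed, line `Sketch` v6): the core certifies clause (i) (`m_crit(k) = thrD > -1`), clause (ii) is free by construction of the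
threshold, and clauses (iii)/(iv) are the three universal laws `stub_lowerAt`, `stub_windowAt` (`N_f = 2`), `stub_deepWindowAt`
(`N_f = 3`), VERBATIM from `Lines/Sketch.lean` v6 (registered there; eleven workers `stub-blocked: none`; inert until the core is
settled, p125170 `universalLaw_or_core`).  A dressing with `m_crit(k)` pinned at `x_u(k)` (the card's prose) would make S3–S4
logically idle — clause (iii) of ANY dressing re-proves the core (`lightMomentFree_of_clauseI_lower`) — and has no composition on
file; recorded, not adopted.  Seven stubs (= stubs_max); `MobilityGap_of` concludes the crux BY NAME.

STATUS after wave 1 (lead a1, 2026-08-16T22:50Z) — LINE-DEAD (`Lines/Ideator6Sketch-dead.md`, `LEAD-c8.md`): all four new stubs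
`stub-blocked` with no existing supplier (S1a: Wegner/FM a-priori bound for Gibbs SU(3) link disorder; S1b: no defined Chern object — and
index-as-parameter retypings are circular, `locallyConstantIndex_iff_exit`, p129479; S2: continuity of the infinite-volume sea law in the bare
mass, unproved anywhere, false in the Sharpe–Singleton branch; S3: pointwise pion long-range order + uniform `q`-moment, the sum rule controlling
row sums only); fragments landed p128834 p128979 p129137 p129255 p128922 p129246 p129247 (+ p128220, p129479).  The skeleton stays registered as
evidence; its stubs are the typed record of what the integer pinch needs.

All stub statements are DEF-FREE below the tree (they mention only tree declarations: `fm`, `propSum`, `qcdLatticeMeasure`,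
`hermitianWilsonDirac`, `fermionDet`, `wilsonDirac`, `wilsonMeasure`, `aSeq`, `betaSeq`, `LineData`, `thrD`, …), so a worker's
file needs no import beyond the tree.
-/

noncomputable section

namespace Summit.QuantumFields.QCD.Theorems.MobilityGapPinch

open scoped BigOperators Topology ComplexConjugate
open MeasureTheory Filter Set Matrix Complex
open Literature.MathematicalPhysics.QuantumFieldTheory Literature.MathematicalPhysics.QuantumLattice
  Literature.Probability.LatticeModels Literature.Barriers.QuantumFields.WilsonDeterminant
open Summit.QuantumFields.QCD.Theorems.MobilityGapSketch

local notation "𝔾₃" => Matrix.specialUnitaryGroup (Fin 3) ℂ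

/-! ### The four new stubs (core chain S1a, S1b, S2, S3) -/

/-- `stub_pocketPlateau` (S1a) — POCKET PLATEAU UNDER EVERY PHASE-QUENCHED SEA.  For `N_f ∈ {2,3}` there is `β₁` such that
for every `β ≥ β₁` and every sea mass `x ∈ [-1, 1]` there are `s ∈ (0,1)`, `E₀ > 0`, `C`, `c > 0` with: for every valence mass
`m₀ ∈ [-3/2, -1]`, every torus of side `2S+1`, every energy `|E| ≤ E₀`, every `η > 0`, every displacement `v` with `|v_i| ≤ S` and
all colour/spin indices, the `|det D_W(U,x,1)|^{N_f}`-reweighted Wilson-measure fractional moment of the `(0,a,α; v,b,γ)` entry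
of `(Γ₅ D_W(U,m₀,1) − E − iη)⁻¹` is `≤ C e^{-c |v|₁}`.  Aizenman–Molchanov localisation of the valence Hermitian Wilson–Dirac kernel
deep in the first doubler pocket (admissibility gap on smooth fields + large-field diluteness + a decoupling usable for Gibbs
SU(3) link disorder), uniformly in the volume and in the sea mass: the sea-uniform, reweighted twin of
`IntegerCriticalLine.InteriorPlateauLocalisation` (stmt-9690, open, L).  Open-problem class (no Wegner/FM theory for non-abelian
Haar link disorder is in print — the route's why-might-fail, met here at its easiest instance). -/
theorem stub_pocketPlateau :
    ∀ Nf : ℕ, Nf = 2 ∨ Nf = 3 → ∃ β₁ : ℝ, ∀ β : ℝ, β₁ ≤ β → ∀ x : ℝ, -1 ≤ x → x ≤ 1 →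
      ∃ s E₀ C c : ℝ, 0 < s ∧ s < 1 ∧ 0 < E₀ ∧ 0 < c ∧ ∀ m₀ : ℝ, -3 / 2 ≤ m₀ → m₀ ≤ -1 →
        ∀ (S : ℕ) (E η : ℝ), |E| ≤ E₀ → 0 < η → ∀ v : Fin 4 → ℤ, (∀ i, |v i| ≤ S) →
          ∀ (a b : Fin 3) (α γ : Fin 4),
            (∫ U : GaugeConfig 4 (2 * S + 1) (Matrix.specialUnitaryGroup (Fin 3) ℂ),
                ‖fermionDet (wilsonDirac (fundamentalRep (Fin 3)) U x 1)‖ ^ Nf *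
                  ‖(hermitianWilsonDirac (fundamentalRep (Fin 3)) U m₀ 1 -
                      ((E : ℂ) + (η : ℂ) * Complex.I) • (1 : Matrix (TorusSite 4 (2 * S + 1) × Fin 3 × Fin 4)
                        (TorusSite 4 (2 * S + 1) × Fin 3 × Fin 4) ℂ))⁻¹
                    ((0 : TorusSite 4 (2 * S + 1)), a, α) (Torus.proj (2 * S + 1) v, b, γ)‖ ^ s
                ∂(wilsonMeasure (d := 4) (L := 2 * S + 1) (fundamentalRep (Fin 3)) β)) /
              (∫ U : GaugeConfig 4 (2 * S + 1) (Matrix.specialUnitaryGroup (Fin 3) ℂ),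
                ‖fermionDet (wilsonDirac (fundamentalRep (Fin 3)) U x 1)‖ ^ Nf
                ∂(wilsonMeasure (d := 4) (L := 2 * S + 1) (fundamentalRep (Fin 3)) β)) ≤
            C * Real.exp (-(c * ∑ i, |(v i : ℝ)|)) := by
  sorry

/-- `stub_valencePinch` (S1b) — THE VALENCE INTEGER PINCH (plateau principle).  For `N_f ∈ {2,3}`: the pocket plateau of
`stub_pocketPlateau` (hypothesis, verbatim) implies `ValenceDelocalisationPQ N_f` — there is `β₁` such that for every `β ≥ β₁`
and every sea mass `x ∈ [-1, 1]` NO constants `s ∈ (0,1)`, `E₀ > 0`, `C`, `c > 0` make the reweighted valence FM bound hold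
simultaneously for all valence masses `m₀ ∈ [-1, 1]` (all tori, `|E| ≤ E₀`, `η > 0`, all displacements and indices).  Intended
proof (card): over ONE fixed covariant link law the disorder-averaged second Chern number of the Fermi projection of
`Γ₅ D_W(m₀)` is an integer, constant on every `m₀`-interval carrying a uniform FM bound (Aizenman–Graf 1998; Prodan–Schulz-Baldes
2016 Thm 6.5.1 / Cor 6.5.2; Germinet–Klein–Schenker 2007); it is `-3` in the pocket and `0` on the trivial plateau `m₀ > 0`
(pathwise gap `‖Γ₅ D_W(m) v‖ ≥ m ‖v‖`), so a bound uniform over `[-1, 1]` glued to the pocket bound on `[-3/2, -1]` is absurd.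
The phase-quenched, sea-uniform twin of `IntegerCriticalLine.CriticalLineExists` (stmt-9692, open, L).  Open-problem class in Lean
(no index / plateau machinery for ergodic link measures exists in the tree or Mathlib). -/
theorem stub_valencePinch :
    ∀ Nf : ℕ, Nf = 2 ∨ Nf = 3 →
      (∃ β₁ : ℝ, ∀ β : ℝ, β₁ ≤ β → ∀ x : ℝ, -1 ≤ x → x ≤ 1 →
        ∃ s E₀ C c : ℝ, 0 < s ∧ s < 1 ∧ 0 < E₀ ∧ 0 < c ∧ ∀ m₀ : ℝ, -3 / 2 ≤ m₀ → m₀ ≤ -1 →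
          ∀ (S : ℕ) (E η : ℝ), |E| ≤ E₀ → 0 < η → ∀ v : Fin 4 → ℤ, (∀ i, |v i| ≤ S) →
            ∀ (a b : Fin 3) (α γ : Fin 4),
              (∫ U : GaugeConfig 4 (2 * S + 1) (Matrix.specialUnitaryGroup (Fin 3) ℂ),
                  ‖fermionDet (wilsonDirac (fundamentalRep (Fin 3)) U x 1)‖ ^ Nf *
                    ‖(hermitianWilsonDirac (fundamentalRep (Fin 3)) U m₀ 1 -
                        ((E : ℂ) + (η : ℂ) * Complex.I) • (1 : Matrix (TorusSite 4 (2 * S + 1) × Fin 3 × Fin 4)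
                          (TorusSite 4 (2 * S + 1) × Fin 3 × Fin 4) ℂ))⁻¹
                      ((0 : TorusSite 4 (2 * S + 1)), a, α) (Torus.proj (2 * S + 1) v, b, γ)‖ ^ s
                  ∂(wilsonMeasure (d := 4) (L := 2 * S + 1) (fundamentalRep (Fin 3)) β)) /
                (∫ U : GaugeConfig 4 (2 * S + 1) (Matrix.specialUnitaryGroup (Fin 3) ℂ),
                  ‖fermionDet (wilsonDirac (fundamentalRep (Fin 3)) U x 1)‖ ^ Nf
                  ∂(wilsonMeasure (d := 4) (L := 2 * S + 1) (fundamentalRep (Fin 3)) β)) ≤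
              C * Real.exp (-(c * ∑ i, |(v i : ℝ)|))) →
      ∃ β₁ : ℝ, ∀ β : ℝ, β₁ ≤ β → ∀ x : ℝ, -1 ≤ x → x ≤ 1 →
        ¬ ∃ s E₀ C c : ℝ, 0 < s ∧ s < 1 ∧ 0 < E₀ ∧ 0 < c ∧ ∀ m₀ : ℝ, -1 ≤ m₀ → m₀ ≤ 1 →
          ∀ (S : ℕ) (E η : ℝ), |E| ≤ E₀ → 0 < η → ∀ v : Fin 4 → ℤ, (∀ i, |v i| ≤ S) →
            ∀ (a b : Fin 3) (α γ : Fin 4),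
              (∫ U : GaugeConfig 4 (2 * S + 1) (Matrix.specialUnitaryGroup (Fin 3) ℂ),
                  ‖fermionDet (wilsonDirac (fundamentalRep (Fin 3)) U x 1)‖ ^ Nf *
                    ‖(hermitianWilsonDirac (fundamentalRep (Fin 3)) U m₀ 1 -
                        ((E : ℂ) + (η : ℂ) * Complex.I) • (1 : Matrix (TorusSite 4 (2 * S + 1) × Fin 3 × Fin 4)
                          (TorusSite 4 (2 * S + 1) × Fin 3 × Fin 4) ℂ))⁻¹
                      ((0 : TorusSite 4 (2 * S + 1)), a, α) (Torus.proj (2 * S + 1) v, b, γ)‖ ^ s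
                  ∂(wilsonMeasure (d := 4) (L := 2 * S + 1) (fundamentalRep (Fin 3)) β)) /
                (∫ U : GaugeConfig 4 (2 * S + 1) (Matrix.specialUnitaryGroup (Fin 3) ℂ),
                  ‖fermionDet (wilsonDirac (fundamentalRep (Fin 3)) U x 1)‖ ^ Nf
                  ∂(wilsonMeasure (d := 4) (L := 2 * S + 1) (fundamentalRep (Fin 3)) β)) ≤
              C * Real.exp (-(c * ∑ i, |(v i : ℝ)|)) := by
  sorry

/-- `stub_unitaryMatching` (S2, THE BET) — THE SEA = VALENCE FIXED POINT.  For `N_f ∈ {2,3}`: `ValenceDelocalisationPQ N_f`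
(hypothesis, verbatim the conclusion of `stub_valencePinch`) implies that at every weak coupling `β ≥ β₁` there is a bare mass
`x_u ∈ (-1, 0]` such that NO constants `s ∈ (0,1)`, `E₀ > 0`, `C`, `c > 0` make the reweighted valence FM bound hold at the
single valence mass `m₀ = x_u` under its OWN sea `x = x_u` (all tori, `|E| ≤ E₀`, `η > 0`, all displacements and indices): the
honest (`N_f = 2`: weight `det²`) / phase-quenched (`N_f = 3`) Hermitian Wilson–Dirac kernel is delocalised at `E = 0` at its
own sea mass — the Aoki point.  Intended proof (card): `g(x) := m₀*_max(x) - x` is `< 0` at `x > 0` (trivial plateau: valence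
`m₀ > 0` is pathwise localised whatever the sea — PROVABLE NOW from `‖Γ₅ D_W(m) v‖ ≥ m‖v‖` and a Combes–Thomas estimate) and
`> 0` at `x = -1` (the pinch), and CONTINUITY of `x ↦ μ_{β,x}` in a topology transporting uniform FM bounds gives a zero.  That
continuity (no first-order transition in the bare mass at weak coupling) is the scenario lock: true in the Aoki scenario, FALSE
in the Sharpe–Singleton scenario (`W₈' + 2W₆' < 0`), which the `N_f = 2` numerics favour (card §Barriers).  Open-problem class. -/
theorem stub_unitaryMatching :
    ∀ Nf : ℕ, Nf = 2 ∨ Nf = 3 →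
      (∃ β₁ : ℝ, ∀ β : ℝ, β₁ ≤ β → ∀ x : ℝ, -1 ≤ x → x ≤ 1 →
        ¬ ∃ s E₀ C c : ℝ, 0 < s ∧ s < 1 ∧ 0 < E₀ ∧ 0 < c ∧ ∀ m₀ : ℝ, -1 ≤ m₀ → m₀ ≤ 1 →
          ∀ (S : ℕ) (E η : ℝ), |E| ≤ E₀ → 0 < η → ∀ v : Fin 4 → ℤ, (∀ i, |v i| ≤ S) →
            ∀ (a b : Fin 3) (α γ : Fin 4),
              (∫ U : GaugeConfig 4 (2 * S + 1) (Matrix.specialUnitaryGroup (Fin 3) ℂ),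
                  ‖fermionDet (wilsonDirac (fundamentalRep (Fin 3)) U x 1)‖ ^ Nf *
                    ‖(hermitianWilsonDirac (fundamentalRep (Fin 3)) U m₀ 1 -
                        ((E : ℂ) + (η : ℂ) * Complex.I) • (1 : Matrix (TorusSite 4 (2 * S + 1) × Fin 3 × Fin 4)
                          (TorusSite 4 (2 * S + 1) × Fin 3 × Fin 4) ℂ))⁻¹
                      ((0 : TorusSite 4 (2 * S + 1)), a, α) (Torus.proj (2 * S + 1) v, b, γ)‖ ^ s
                  ∂(wilsonMeasure (d := 4) (L := 2 * S + 1) (fundamentalRep (Fin 3)) β)) /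
                (∫ U : GaugeConfig 4 (2 * S + 1) (Matrix.specialUnitaryGroup (Fin 3) ℂ),
                  ‖fermionDet (wilsonDirac (fundamentalRep (Fin 3)) U x 1)‖ ^ Nf
                  ∂(wilsonMeasure (d := 4) (L := 2 * S + 1) (fundamentalRep (Fin 3)) β)) ≤
              C * Real.exp (-(c * ∑ i, |(v i : ℝ)|))) →
      ∃ β₁ : ℝ, ∀ β : ℝ, β₁ ≤ β → ∃ x : ℝ, -1 < x ∧ x ≤ 0 ∧
        ¬ ∃ s E₀ C c : ℝ, 0 < s ∧ s < 1 ∧ 0 < E₀ ∧ 0 < c ∧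
          ∀ (S : ℕ) (E η : ℝ), |E| ≤ E₀ → 0 < η → ∀ v : Fin 4 → ℤ, (∀ i, |v i| ≤ S) →
            ∀ (a b : Fin 3) (α γ : Fin 4),
              (∫ U : GaugeConfig 4 (2 * S + 1) (Matrix.specialUnitaryGroup (Fin 3) ℂ),
                  ‖fermionDet (wilsonDirac (fundamentalRep (Fin 3)) U x 1)‖ ^ Nf *
                    ‖(hermitianWilsonDirac (fundamentalRep (Fin 3)) U x 1 -
                        ((E : ℂ) + (η : ℂ) * Complex.I) • (1 : Matrix (TorusSite 4 (2 * S + 1) × Fin 3 × Fin 4)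
                          (TorusSite 4 (2 * S + 1) × Fin 3 × Fin 4) ℂ))⁻¹
                      ((0 : TorusSite 4 (2 * S + 1)), a, α) (Torus.proj (2 * S + 1) v, b, γ)‖ ^ s
                  ∂(wilsonMeasure (d := 4) (L := 2 * S + 1) (fundamentalRep (Fin 3)) β)) /
                (∫ U : GaugeConfig 4 (2 * S + 1) (Matrix.specialUnitaryGroup (Fin 3) ℂ),
                  ‖fermionDet (wilsonDirac (fundamentalRep (Fin 3)) U x 1)‖ ^ Nf
                  ∂(wilsonMeasure (d := 4) (L := 2 * S + 1) (fundamentalRep (Fin 3)) β)) ≤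
              C * Real.exp (-(c * ∑ i, |(v i : ℝ)|)) := by
  sorry

/-- `stub_aokiLRO` (S3) — LONG-RANGE ORDER AT THE UNITARY POINT, IN SECOND-MOMENT CURRENCY.  For `N_f ∈ {2,3}`: the existence of
unitary points at every weak coupling (hypothesis, verbatim the conclusion of `stub_unitaryMatching`) implies, along the canonical
admissible data `a_k = aSeq k = e^{-(k+1)}`, `β_k = betaSeq N_f k = afBeta N_f 1 a_k` (`β_k → ∞`), the ideator's
`SecondMomentPoint N_f aSeq (betaSeq N_f) q` for some `q > 2` (unfolded): eventually in `k`, at SOME bare mass `x > -1` (the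
unitary point `x_u(β_k)`, or a sea mass just inside its parity-flavour-broken finger) and some flavour `f`, the phase-quenched
SECOND moment `fm … 2` of the propagator entry sum `Σ_{colour,spin} |D_W(x)⁻¹(0, n e₀)|` is bounded BELOW by `c > 0` for all tori
`S ≥ S₀` and all `n ≤ S` (long-range order of the charged-pion correlator `E‖G(0,v)‖²_F`), while the `q`-th moment is bounded
above by `C` and integrable.  Intended proof (card): delocalisation at the Aoki point ⇔ extended zero-modes of `Γ₅ D_W(x_u)` ⇔
`⟨ψ̄ iγ₅ τ³ ψ⟩ ≠ 0` (Banks–Casher for `H_W`); the exact twisted Ward sum rule `ω Σ_q |A_ω⁻¹(p,q)|² = -Im(A_ω⁻¹Γ₅)(p,p)`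
(landed `twistedWardSumRule_wilson`) turns the one-point order parameter into two-point reach; (g2) Cesàro LRO ⇒ pointwise along
the axis; the `q`-moment (`2 < q < 3`) from the small-eigenvalue density `∝ λ²` under `det²`.  By the card's own account step (g2)
is OPEN as typed (periodic quarks, odd tori).  Open-problem class. -/
theorem stub_aokiLRO :
    ∀ Nf : ℕ, Nf = 2 ∨ Nf = 3 →
      (∃ β₁ : ℝ, ∀ β : ℝ, β₁ ≤ β → ∃ x : ℝ, -1 < x ∧ x ≤ 0 ∧
        ¬ ∃ s E₀ C c : ℝ, 0 < s ∧ s < 1 ∧ 0 < E₀ ∧ 0 < c ∧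
          ∀ (S : ℕ) (E η : ℝ), |E| ≤ E₀ → 0 < η → ∀ v : Fin 4 → ℤ, (∀ i, |v i| ≤ S) →
            ∀ (a b : Fin 3) (α γ : Fin 4),
              (∫ U : GaugeConfig 4 (2 * S + 1) (Matrix.specialUnitaryGroup (Fin 3) ℂ),
                  ‖fermionDet (wilsonDirac (fundamentalRep (Fin 3)) U x 1)‖ ^ Nf *
                    ‖(hermitianWilsonDirac (fundamentalRep (Fin 3)) U x 1 -
                        ((E : ℂ) + (η : ℂ) * Complex.I) • (1 : Matrix (TorusSite 4 (2 * S + 1) × Fin 3 × Fin 4)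
                          (TorusSite 4 (2 * S + 1) × Fin 3 × Fin 4) ℂ))⁻¹
                      ((0 : TorusSite 4 (2 * S + 1)), a, α) (Torus.proj (2 * S + 1) v, b, γ)‖ ^ s
                  ∂(wilsonMeasure (d := 4) (L := 2 * S + 1) (fundamentalRep (Fin 3)) β)) /
                (∫ U : GaugeConfig 4 (2 * S + 1) (Matrix.specialUnitaryGroup (Fin 3) ℂ),
                  ‖fermionDet (wilsonDirac (fundamentalRep (Fin 3)) U x 1)‖ ^ Nf
                  ∂(wilsonMeasure (d := 4) (L := 2 * S + 1) (fundamentalRep (Fin 3)) β)) ≤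
              C * Real.exp (-(c * ∑ i, |(v i : ℝ)|))) →
      ∃ q : ℝ, 2 < q ∧ ∀ᶠ k in atTop, ∃ x : ℝ, -1 < x ∧ ∃ (f : Fin Nf) (c C : ℝ), 0 < c ∧ ∃ S₀ : ℕ,
        ∀ S : ℕ, S₀ ≤ S → ∀ n : ℕ, n ≤ S →
          c ≤ fm Nf (betaSeq Nf k) (fun _ => x) S f (Pi.single 0 (n : ℤ)) 2 ∧
            fm Nf (betaSeq Nf k) (fun _ => x) S f (Pi.single 0 (n : ℤ)) q ≤ C ∧
              Integrable (fun U => propSum Nf S (fun _ => x) f (Pi.single 0 (n : ℤ)) U ^ q)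
                (qcdLatticeMeasure (2 * S + 1) (betaSeq Nf k) (fun _ : Fin Nf => x)) := by
  sorry

/-! ### S4 (closed): Hölder descent from the second moment to the core -/

/-- **Moment interpolation (Hölder / Lyapunov).** On a probability space, for a non-negative measurable
`X` with `X^q` integrable and exponents `0 < s < 2 < q`:
`∫ X² ≤ (∫ X^s)^{(q-2)/(q-s)} · (∫ X^q)^{(2-s)/(q-s)}`. -/
private theorem moment_interpolation {α : Type*} [MeasurableSpace α] {μ : Measure α} [IsProbabilityMeasure μ]
    {X : α → ℝ} (hX : Measurable X) (hX0 : ∀ a, 0 ≤ X a) {s q : ℝ} (hs : 0 < s) (hs2 : s < 2)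
    (hq : 2 < q) (hint : Integrable (fun a => X a ^ q) μ) :
    ∫ a, X a ^ (2 : ℝ) ∂μ ≤
      (∫ a, X a ^ s ∂μ) ^ ((q - 2) / (q - s)) * (∫ a, X a ^ q ∂μ) ^ ((2 - s) / (q - s)) := by
  -- exponents
  set θ : ℝ := (q - 2) / (q - s) with hθ
  have hqs : 0 < q - s := by linarith
  have hθ0 : 0 < θ := div_pos (by linarith) hqs
  have hθ1 : θ < 1 := by rw [hθ, div_lt_one hqs]; linarith
  have h1θ : 0 < 1 - θ := by linarith
  have hθ' : 1 - θ = (2 - s) / (q - s) := by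
    rw [hθ]; field_simp; ring
  -- Hölder conjugate exponents p = 1/θ, p' = 1/(1-θ)
  set p : ℝ := 1 / θ with hp
  set p' : ℝ := 1 / (1 - θ) with hp'
  have hp0 : 0 < p := by rw [hp]; positivity
  have hp'0 : 0 < p' := by rw [hp']; positivity
  have hpq : p.HolderConjugate p' := by
    refine ⟨?_, hp0, hp'0⟩
    rw [hp, hp', one_div, one_div, inv_inv, inv_inv, inv_one]
    ring
  -- the two factors
  set f : α → ℝ := fun a => X a ^ (θ * s) with hf
  set g : α → ℝ := fun a => X a ^ ((1 - θ) * q) with hg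
  have hf0 : ∀ a, 0 ≤ f a := fun a => Real.rpow_nonneg (hX0 a) _
  have hg0 : ∀ a, 0 ≤ g a := fun a => Real.rpow_nonneg (hX0 a) _
  have hfp : ∀ a, f a ^ p = X a ^ s := by
    intro a
    rw [hf, hp]
    simp only
    rw [← Real.rpow_mul (hX0 a)]
    congr 1
    field_simp
  have hgp : ∀ a, g a ^ p' = X a ^ q := by
    intro a
    rw [hg, hp']
    simp only
    rw [← Real.rpow_mul (hX0 a)]
    congr 1
    field_simp
  have hfg : ∀ a, f a * g a = X a ^ (2 : ℝ) := by
    intro a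
    rw [hf, hg]
    simp only
    rw [← Real.rpow_add' (hX0 a)]
    · congr 1
      rw [hθ]; field_simp; ring
    · have : θ * s + (1 - θ) * q = 2 := by rw [hθ]; field_simp; ring
      rw [this]; norm_num
  -- integrability of lower powers on a probability space: `X^t ≤ 1 + X^q` for `0 ≤ t ≤ q`
  have hdom : ∀ {t : ℝ}, 0 ≤ t → t ≤ q → Integrable (fun a => X a ^ t) μ := by
    intro t ht0 htq
    refine Integrable.mono' ((integrable_const (1 : ℝ)).add hint)
      ((hX.pow_const t).aestronglyMeasurable) (Eventually.of_forall fun a => ?_)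
    rw [Real.norm_eq_abs, abs_of_nonneg (Real.rpow_nonneg (hX0 a) _)]
    by_cases hx1 : X a ≤ 1
    · calc X a ^ t ≤ 1 := Real.rpow_le_one (hX0 a) hx1 ht0
        _ ≤ 1 + X a ^ q := le_add_of_nonneg_right (Real.rpow_nonneg (hX0 a) _)
    · push Not at hx1
      calc X a ^ t ≤ X a ^ q := Real.rpow_le_rpow_of_exponent_le hx1.le htq
        _ ≤ 1 + X a ^ q := le_add_of_nonneg_left zero_le_one
  -- MemLp of the factors
  have hθs0 : 0 ≤ θ * s := by positivity
  have hfmeas : AEStronglyMeasurable f μ := (hX.pow_const _).aestronglyMeasurable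
  have hgmeas : AEStronglyMeasurable g μ := (hX.pow_const _).aestronglyMeasurable
  have hfLp : MemLp f (ENNReal.ofReal p) μ := by
    rw [← integrable_norm_rpow_iff hfmeas (by simp [hp0]) ENNReal.ofReal_ne_top]
    rw [ENNReal.toReal_ofReal hp0.le]
    have : (fun a => ‖f a‖ ^ p) = fun a => X a ^ s := by
      funext a; rw [Real.norm_eq_abs, abs_of_nonneg (hf0 a), hfp a]
    rw [this]
    exact hdom hs.le (by linarith)
  have hgLp : MemLp g (ENNReal.ofReal p') μ := by
    rw [← integrable_norm_rpow_iff hgmeas (by simp [hp'0]) ENNReal.ofReal_ne_top]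
    rw [ENNReal.toReal_ofReal hp'0.le]
    have : (fun a => ‖g a‖ ^ p') = fun a => X a ^ q := by
      funext a; rw [Real.norm_eq_abs, abs_of_nonneg (hg0 a), hgp a]
    rw [this]
    exact hint
  have hH := integral_mul_le_Lp_mul_Lq_of_nonneg hpq (Eventually.of_forall hf0)
    (Eventually.of_forall hg0) hfLp hgLp
  -- rewrite Hölder's conclusion
  have e1 : (fun a => f a * g a) = fun a => X a ^ (2 : ℝ) := funext hfg
  have e2 : (fun a => f a ^ p) = fun a => X a ^ s := funext hfp
  have e3 : (fun a => g a ^ p') = fun a => X a ^ q := funext hgp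
  rw [show (∫ a, f a * g a ∂μ) = ∫ a, X a ^ (2 : ℝ) ∂μ from by rw [e1],
    show (∫ a, f a ^ p ∂μ) = ∫ a, X a ^ s ∂μ from by rw [e2],
    show (∫ a, g a ^ p' ∂μ) = ∫ a, X a ^ q ∂μ from by rw [e3]] at hH
  have hp1 : 1 / p = θ := by rw [hp, one_div_one_div]
  have hp'1 : 1 / p' = (2 - s) / (q - s) := by rw [hp', one_div_one_div, hθ']
  rw [hp1, hp'1] at hH
  exact hH



/-- `SecondMomentPoint Nf a β q` (the ideator's typed output of S3, kept as glue): eventually in `k`, at SOME bare mass `x > -1`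
and flavour `f`, the phase-quenched SECOND moment of the propagator entry sum is bounded BELOW pointwise along the time axis, and
the `q`-th moment is bounded ABOVE and INTEGRABLE, uniformly in all large tori. -/
def SecondMomentPoint (Nf : ℕ) (_a β : ℕ → ℝ) (q : ℝ) : Prop :=
  ∀ᶠ k in atTop, ∃ x : ℝ, -1 < x ∧ ∃ (f : Fin Nf) (c C : ℝ), 0 < c ∧ ∃ S₀ : ℕ,
    ∀ S : ℕ, S₀ ≤ S → ∀ n : ℕ, n ≤ S →
      c ≤ fm Nf (β k) (fun _ => x) S f (Pi.single 0 (n : ℤ)) 2 ∧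
        fm Nf (β k) (fun _ => x) S f (Pi.single 0 (n : ℤ)) q ≤ C ∧
          Integrable (fun U => propSum Nf S (fun _ => x) f (Pi.single 0 (n : ℤ)) U ^ q)
            (qcdLatticeMeasure (2 * S + 1) (β k) (fun _ : Fin Nf => x))

/-- `fm` is non-negative. -/
theorem fm_nonneg (Nf : ℕ) (β : ℝ) (t : Fin Nf → ℝ) (S : ℕ) (f : Fin Nf)
    (v : Literature.Probability.LatticeModels.Site 4) (s : ℝ) : 0 ≤ fm Nf β t S f v s := by
  rw [fm_eq_integral]
  exact integral_nonneg fun U => Real.rpow_nonneg (propSum_nonneg Nf S t f v U) _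

/-- **Hölder descent (S4, the ideator's proof).** A pointwise second-moment lower bound with a uniform integrable `q`-moment bound,
`2 < q`, gives the light `s`-moment for every `s ∈ (0,1)` with rate `r = 0`. -/
theorem lightMomentAt_of_secondMomentPoint {Nf : ℕ} {a β : ℕ → ℝ} {q : ℝ} (hq : 2 < q)
    (h : SecondMomentPoint Nf a β q) {s : ℝ} (hs : 0 < s) (hs1 : s < 1) :
    LightMomentAt Nf a β s := by
  refine ⟨0, ?_⟩
  filter_upwards [h] with k hk
  obtain ⟨x, hx, f, c, C, hc, S₀, hS⟩ := hk
  have hs2 : s < 2 := by linarith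
  have hqs : 0 < q - s := by linarith
  set θ : ℝ := (q - 2) / (q - s) with hθ
  set e : ℝ := (2 - s) / (q - s) with he
  have hθ0 : 0 < θ := div_pos (by linarith) hqs
  have he0 : 0 < e := div_pos (by linarith) hqs
  -- `C > 0`, from the instance `S = S₀`, `n = 0`
  have hmain : ∀ S : ℕ, S₀ ≤ S → ∀ n : ℕ, n ≤ S →
      c ≤ fm Nf (β k) (fun _ => x) S f (Pi.single 0 (n : ℤ)) s ^ θ * C ^ e ∧ 0 < C := by
    intro S hS0 n hn
    obtain ⟨h2, hqC, hint⟩ := hS S hS0 n hn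
    haveI := isProbabilityMeasure_qcdLatticeMeasure_all (S := 2 * S + 1) (β k) (fun _ : Fin Nf => x)
    have hI := moment_interpolation (μ := qcdLatticeMeasure (2 * S + 1) (β k) (fun _ : Fin Nf => x))
      (measurable_propSum Nf S (fun _ => x) f (Pi.single 0 (n : ℤ)))
      (propSum_nonneg Nf S (fun _ => x) f (Pi.single 0 (n : ℤ))) hs hs2 hq hint
    rw [← fm_eq_integral, ← fm_eq_integral, ← fm_eq_integral] at hI
    have hB0 : 0 ≤ fm Nf (β k) (fun _ => x) S f (Pi.single 0 (n : ℤ)) q := fm_nonneg _ _ _ _ _ _ _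
    have hA0 : 0 ≤ fm Nf (β k) (fun _ => x) S f (Pi.single 0 (n : ℤ)) s := fm_nonneg _ _ _ _ _ _ _
    have hC0 : 0 < C := by
      by_contra hC
      push Not at hC
      have hB : fm Nf (β k) (fun _ => x) S f (Pi.single 0 (n : ℤ)) q = 0 := le_antisymm (hqC.trans hC) hB0
      rw [hB, Real.zero_rpow he0.ne', mul_zero] at hI
      linarith
    refine ⟨?_, hC0⟩
    calc c ≤ fm Nf (β k) (fun _ => x) S f (Pi.single 0 (n : ℤ)) 2 := h2
      _ ≤ _ := hI
      _ ≤ fm Nf (β k) (fun _ => x) S f (Pi.single 0 (n : ℤ)) s ^ θ * C ^ e := by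
        gcongr
  obtain ⟨-, hC0⟩ := hmain S₀ le_rfl 0 (Nat.zero_le _)
  have hCe : 0 < C ^ e := Real.rpow_pos_of_pos hC0 e
  set c' : ℝ := (c / C ^ e) ^ (1 / θ) with hc'
  have hc'0 : 0 < c' := Real.rpow_pos_of_pos (div_pos hc hCe) _
  refine ⟨x, hx, f, c', hc'0, S₀, fun S hS0 n hn => ?_⟩
  rw [zero_mul, neg_zero, Real.exp_zero, mul_one]
  obtain ⟨hineq, -⟩ := hmain S hS0 n hn
  have hA0 : 0 ≤ fm Nf (β k) (fun _ => x) S f (Pi.single 0 (n : ℤ)) s := fm_nonneg _ _ _ _ _ _ _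
  have hAθ : c / C ^ e ≤ fm Nf (β k) (fun _ => x) S f (Pi.single 0 (n : ℤ)) s ^ θ := by
    rw [div_le_iff₀ hCe]; exact hineq
  calc c' = (c / C ^ e) ^ (1 / θ) := rfl
    _ ≤ (fm Nf (β k) (fun _ => x) S f (Pi.single 0 (n : ℤ)) s ^ θ) ^ (1 / θ) :=
        Real.rpow_le_rpow (div_pos hc hCe).le hAθ (by positivity)
    _ = fm Nf (β k) (fun _ => x) S f (Pi.single 0 (n : ℤ)) s := by
        rw [one_div, Real.rpow_rpow_inv hA0 hθ0.ne']

/-- The canonical couplings `betaSeq N_f` sit exactly on the two-loop profile of the canonical spacings (`Λ = 1`). -/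
theorem betaSeq_scaling (Nf : ℕ) :
    ∃ Λ > (0 : ℝ), Tendsto (fun k => betaSeq Nf k - afBeta Nf Λ (aSeq k)) atTop (𝓝 0) :=
  ⟨1, one_pos, tendsto_const_nhds.congr' (Eventually.of_forall fun k => by
    show (0 : ℝ) = betaSeq Nf k - afBeta Nf 1 (aSeq k); rw [betaSeq, sub_self])⟩

/-- **The core from the four new stubs (S1a → S1b → S2 → S3 → S4).**  `LawLightFree` — for `N_f ∈ {2,3}`, `LightMomentFree N_f`
— along the canonical data `(aSeq, betaSeq N_f)`, exponent `s = 1/2`, rate `0`. -/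
theorem lawLightFree_of_pinch : LawLightFree := by
  intro Nf hNf
  obtain ⟨q, hq, hSM⟩ :=
    stub_aokiLRO Nf hNf (stub_unitaryMatching Nf hNf (stub_valencePinch Nf hNf (stub_pocketPlateau Nf hNf)))
  have h : SecondMomentPoint Nf aSeq (betaSeq Nf) q := hSM
  exact ⟨aSeq, betaSeq Nf, aSeq_pos, tendsto_aSeq, betaSeq_scaling Nf, 1 / 2, by norm_num, by norm_num,
    lightMomentAt_of_secondMomentPoint hq h (by norm_num) (by norm_num)⟩

/-! ### The dressing: the three universal laws of `Lines/Sketch.lean` v6, verbatim -/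

/-- `stub_lowerAt` — CLAUSE (iii) IN THE RENORMALISED WINDOW ABOVE THE THRESHOLD, ALONG EVERY LIGHT DATUM (= `LawLowerFree`;
verbatim from `Lines/Sketch.lean` v6).  For `N_f ∈ {2,3}` and every admissible datum `d` carrying a light `d.s`-moment, for every
large `δ` and every `M > 0` there are `s ∈ (0,1)`, `c₀ > 0`, `C₁`, `p` such that eventually in `k`: if the floor set is non-empty
and `-1 < m_crit(k) = thrD d δ k`, every bare tuple `t ∈ (m_crit(k), m_crit(k) + a_k M/Z_m(k)]^{N_f}` obeys
`c₀ e^{-C₁ a_k n}(n+1)^{-p} ≤ fm(β_k, t, S, f, n e₀, s)` on all tori `S ≥ L⁰_k`, all `f`, all `n ≤ S`.  Content: GMOR-type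
scaling of the charged correlation length just above the unitary point, no jump of the physical rate across the decay threshold,
`k`-uniform UV corner, volume/direction transport — for the interacting phase-quenched Wilson measure.  Open-problem class; inert
until the core is settled (p125170 `core_of_not_lawLowerFree`). -/
theorem stub_lowerAt :
    ∀ Nf : ℕ, Nf = 2 ∨ Nf = 3 → ∀ d : LineData Nf, LightMomentAt Nf d.a d.β d.s →
      ∀ᶠ δ in atTop, ∀ M : ℝ, 0 < M → ∃ s c₀ C₁ p : ℝ, 0 < s ∧ s < 1 ∧ 0 < c₀ ∧ ∀ᶠ k in atTop,
        (floorSetD d δ k).Nonempty → -1 < thrD d δ k → ∀ t : Fin Nf → ℝ,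
          (∀ f, thrD d δ k < t f) → (∀ f, t f ≤ thrD d δ k + d.a k * M / d.zm k) →
            ∀ S : ℕ, d.vfloor k ≤ S → ∀ (f : Fin Nf) (n : ℕ), n ≤ S →
              c₀ * Real.exp (-(C₁ * (d.a k * n) + p * Real.log (n + 1))) ≤
                fm Nf (d.β k) t S f (Pi.single 0 (n : ℤ)) s := by
  sorry

/-- `stub_windowAt` — TWO FLAVOURS: REAL MODES IN THE MASS-SPLITTING WINDOW ARE RARE AT THE SCHEME'S OWN VOLUME, ALONG EVERY
LIGHT DATUM (verbatim from `Lines/Sketch.lean` v6, reshape 4).  For every admissible two-flavour datum `d` carrying a light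
`d.s`-moment there is an admissible volume sequence `L ≥ L⁰` (eventually) such that for every large `δ`, every `M > 0`, eventually
in `k`: if the floor set is non-empty and `-1 < m_crit(k)`, then for every window pair `t ∈ (m_crit(k), m_crit(k) + a_k M/Z_m(k)]²`
the phase-quenched expected number of real eigenvalues of `D_W(U,0,1)` in the open spread window `(-max t, -min t)` on the torus of
side `2L_k+1` at coupling `β_k` is `≤ 1/4` (glued to clause (iv) at `N_f = 2` by the landed `signAt_of_windowAt`).  A Wegner-type
estimate for the interacting phase-quenched measure.  Open-problem class; inert until the core is settled (p125170). -/
theorem stub_windowAt :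
    ∀ d : LineData 2, LightMomentAt 2 d.a d.β d.s →
      ∃ L : ℕ → ℕ, Tendsto (fun k => d.a k * (L k : ℝ)) atTop atTop ∧ (∀ᶠ k in atTop, d.vfloor k ≤ L k) ∧
        ∀ᶠ δ in atTop, ∀ M : ℝ, 0 < M → ∀ᶠ k in atTop,
          (floorSetD d δ k).Nonempty → -1 < thrD d δ k → ∀ t : Fin 2 → ℝ,
            (∀ f, thrD d δ k < t f) → (∀ f, t f ≤ thrD d δ k + d.a k * M / d.zm k) →
              (∫ U : GaugeConfig 4 (2 * L k + 1) (Matrix.specialUnitaryGroup (Fin 3) ℂ),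
                  ((wilsonDirac (fundamentalRep (Fin 3)) U 0 1).charpoly.roots.countP
                      (fun z : ℂ => z.im = 0 ∧ -max (t 0) (t 1) < z.re ∧ z.re < -min (t 0) (t 1)) : ℝ) *
                    ∏ f : Fin 2, ‖fermionDet (wilsonDirac (fundamentalRep (Fin 3)) U (t f) 1)‖
                  ∂(wilsonMeasure (d := 4) (L := 2 * L k + 1) (fundamentalRep (Fin 3)) (d.β k))) /
                (∫ U : GaugeConfig 4 (2 * L k + 1) (Matrix.specialUnitaryGroup (Fin 3) ℂ),
                  ∏ f : Fin 2, ‖fermionDet (wilsonDirac (fundamentalRep (Fin 3)) U (t f) 1)‖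
                  ∂(wilsonMeasure (d := 4) (L := 2 * L k + 1) (fundamentalRep (Fin 3)) (d.β k))) ≤ 1 / 4 := by
  sorry

/-- `stub_deepWindowAt` — THREE FLAVOURS: DEEP CROSSERS AND WINDOW MODES ARE RARE AT THE SCHEME'S OWN VOLUME, ALONG EVERY LIGHT
DATUM (verbatim from `Lines/Sketch.lean` v6, reshape 5).  For every admissible three-flavour datum `d` carrying a light
`d.s`-moment there is an admissible volume sequence `L ≥ L⁰` (eventually) such that for every large `δ`, every `M > 0`, eventually
in `k`: if the floor set is non-empty and `-1 < m_crit(k)`, then for every window triple `t` the phase-quenched expected number of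
real eigenvalues of `D_W(U,0,1)` that are DEEP (below every bare mass of the triple) or in the spread WINDOW (strictly between two
of them) on the torus of side `2L_k+1` at coupling `β_k` is `≤ 1/4` (glued to clause (iv) at `N_f = 3` by `signAt_of_deepWindowAt`).
The Lifshitz-tail / dislocation statement of the route (`S_disl·b₀ > 1`) plus the `N_f = 3` window law.  Open-problem class;
inert until the core is settled (p125170). -/
theorem stub_deepWindowAt :
    ∀ d : LineData 3, LightMomentAt 3 d.a d.β d.s →
      ∃ L : ℕ → ℕ, Tendsto (fun k => d.a k * (L k : ℝ)) atTop atTop ∧ (∀ᶠ k in atTop, d.vfloor k ≤ L k) ∧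
        ∀ᶠ δ in atTop, ∀ M : ℝ, 0 < M → ∀ᶠ k in atTop,
          (floorSetD d δ k).Nonempty → -1 < thrD d δ k → ∀ t : Fin 3 → ℝ,
            (∀ f, thrD d δ k < t f) → (∀ f, t f ≤ thrD d δ k + d.a k * M / d.zm k) →
              (∫ U : GaugeConfig 4 (2 * L k + 1) (Matrix.specialUnitaryGroup (Fin 3) ℂ),
                  (((wilsonDirac (fundamentalRep (Fin 3)) U 0 1).charpoly.roots.countP
                      (fun z : ℂ => z.im = 0 ∧ ∀ f, z.re < -t f) : ℝ) +
                    ((wilsonDirac (fundamentalRep (Fin 3)) U 0 1).charpoly.roots.countP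
                      (fun z : ℂ => z.im = 0 ∧ (∃ f, z.re < -t f) ∧ ∃ g, -t g < z.re) : ℝ)) *
                    ∏ f : Fin 3, ‖fermionDet (wilsonDirac (fundamentalRep (Fin 3)) U (t f) 1)‖
                  ∂(wilsonMeasure (d := 4) (L := 2 * L k + 1) (fundamentalRep (Fin 3)) (d.β k))) /
                (∫ U : GaugeConfig 4 (2 * L k + 1) (Matrix.specialUnitaryGroup (Fin 3) ℂ),
                  ∏ f : Fin 3, ‖fermionDet (wilsonDirac (fundamentalRep (Fin 3)) U (t f) 1)‖
                  ∂(wilsonMeasure (d := 4) (L := 2 * L k + 1) (fundamentalRep (Fin 3)) (d.β k))) ≤ 1 / 4 := by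
  sorry

/-! ### Deciding theorem -/

/-- **Deciding theorem of line `Ideator6Sketch`**: the crux `MobilityGap` BY NAME — the core from the integer-pinch chain
(`lawLightFree_of_pinch`: S1a, S1b, S2, S3 and the closed S4), dressed by the landed threshold composition
`MobilityGap_of_freeLaws_deepWindow` with the three universal laws. -/
theorem MobilityGap_of : Summit.QuantumFields.QCD.Theses.WilsonMobilityGap.MobilityGap :=
  MobilityGap_of_freeLaws_deepWindow lawLightFree_of_pinch stub_lowerAt stub_windowAt stub_deepWindowAt

end Summit.QuantumFields.QCD.Theorems.MobilityGapPinch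

end
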